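import Summits.ResolutionOfSingularities.ResolutionOfSingularities.Theorems.EquisingularLiftEquisingularLiftNatResidueHypDefsE8
import HarnessLib

/-!
# [OURS · L1 W4.5(b) · EL♮ / EL♮(3)] RESIDUE HYPOTHESIS DEFS E9 — WIDTH TABLE D17 «STAGE-0 TOWER BOOKKEEPING»: the carrier-free tower letters `TowerPtRegB₅` /
# `TowerRoundB₅`, the initial-stage door `ReachTowerNose₀` and the blob `NoseHypHostedNestEquinodalDirectCILiftTowerZeroSigmaPGBTriplePrime₂`

Typed by res-type-027 g24 on the desk's RULING R81 (2026-08-29T12:37:56Z, «D17 IS DEALT as the 52nd count-neutral NOSE REPLACE blob E8 ↦ E9»;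
customer #4 «rational (6,10,15)-nose» H₁₀ ⊃ Z₁₅, lead-1 `EQUISINGULAR-NOSES.md` v1.5a 0cd90ae3eb6efde7 (6.6); sizing idea-2 g31 ★ `D17-SIZING-idea2.md` v1
c53e9159a56ae8bd §2 (T1)–(T5); typer's paper sketch `D17-BINDER-SKETCH.md` c16f1eabe312ff27; gate (c) PASS ×2: crit-3 g12 letters + token dc1a1b321233f4de,
crit-2 g13 by tool (independent scratch typing token-identical to the pre-draft 60863105e6243f62, whose code tokens these bytes keep).
WHAT.  (T1) `TowerPtRegB₅ F₁₀ R` = ✓ `TowerPtRegB₄` (…TowerRoundBTriplePrimeDefs :46–:59) VERBATIM except that the two occurrences of `curvePt G T y ∉ F ∧`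
(E-menu third arm, `Es'`-menu first arm) are DELETED: a member THROUGH the point may stay MODEL-CARRYING as its strict transform `closure υ₂⁻¹(F ∖ {y})`
(idea-3 PS-2 / stub-4 (E4): engine brick `exc₄_transport_through`); the K-keeping second arm, the K'-menu and the `Ns'`-menu are verbatim.
(T2) `TowerRoundB₅ F₁₀ R` = ✓ `TowerRoundBTriplePrime` (:89–:134) with the CARRIER TOKENS DELETED: signature `(F₉ F₁₀ υ' Z₉ hZ₉ R) ↦ (F₁₀ R)`;
`TowerFull …` in branches 1, 2 and the first disjunct of branch 3's dimension hypothesis REPLACED by the dimension clause `hZdim` (branch 3's own spelling);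
sub-branch 1(i) (the `DirStepSec` / `RationalCarrier` / `ConeWitness` section round over the carrier) DELETED; branch 4 (K-fibre), the blow-up,
`RoundTransportOKDoublePrime`, `Ns'` and the conclusion VERBATIM.  (T3) the door `ReachTowerNose₀ k n T₁ F₉ β T₉ E₉`: `E₉ = ∅` and a motive
`R G γ T E Es Ns K` SEEDED AT THE STAGE ITSELF — `R ℙⁿ (𝟙 _) T₁ ∅ [] [] ∅` (no nose blow-up, no carrier, no slot, no curve clause; host `∅`, empty lists:
the outer planes are BORN by (T1)'s `υ₂⁻¹{y}` arms, nothing is seeded) — closed under `TowerPtRegB₅`, `TowerPtRamB₄` (verbatim) and `TowerRoundB₅`, reaching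
`R F₉ β T₉ E' Es' Ns' K'`.  (T4) the blob = ✓ blob E8 (…DefsE8 :139–:181) VERBATIM with a FIFTH initial-menu disjunct `ReachTowerNose₀ k n (Set.range ι) F₉ β T₉ E₉`.
(T5) pure logic: `TowerPtRegB₅ ⇒ TowerPtRegB₄` on motives (wider rule ⇒ closed under the narrower), E8-blob ⇒ E9-blob (`Or.inl`), and the REPLACE chain
`not_…LiftSigmaPG…₂_of_not_liftTowerZeroSigmaPG₂` down to `NoseHypPointsFirstBTriplePrime`.  Engine side (not here; stub-4 / nose-w1 per the desk): seed
(S0-a), ✓ `invB₄_ptRegStep` + `exc₄_transport_through` + constrained section, `invB₄_ptRamStep` verbatim, round-closure twin over ✓ cores, driver, exit,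
rung `tower_nose₀_rung_three` = ✓ `nose_lift_rung_three` + one dispatcher case.  OURS; NAMED HYPOTHESES, not statements of any manuscript ([Hironaka2017]
is a candidate under adjudication, nothing of it is asserted); AI-written, weaker than expert review; definitions + pure logic only, no instance, no
notation, standard axioms; EL♮(3) NOT proved; resolution in positive characteristic NOT proved.  `--kind definition --supports stmt-ResolutionOfSingularities-20148 --as helper`.
-/

set_option linter.dupNamespace false
noncomputable section
open CategoryTheory CategoryTheory.Limits AlgebraicGeometry TopologicalSpace Topology IsLocalRing
open Literature.AlgebraicGeometry.Resolution
open AlgebraicGeometry.Scheme.IdealSheafData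
namespace Summit.ResolutionOfSingularities.ResolutionOfSingularities.Cruxes.EquisingularLiftNat.Sections

/-- **`TowerPtRegB₅ F₁₀ R`** — (T1) the REGULAR POINT STEP of the stage-0 tower (WIDTH TABLE D17): ✓ `TowerPtRegB₄` VERBATIM except that a member of `E :: Es`
THROUGH the point may be kept MODEL-CARRYING (as the running surface — third E-arm — or in `Es'`) as its strict transform `closure υ₂⁻¹(F ∖ {y})`: the two
`curvePt G T y ∉ F ∧` conjuncts of the B‴ text are deleted, nothing else moves. [OURS · named hypothesis fragment, no mathematical content of its own] -/
def TowerPtRegB₅ (F₁₀ : Scheme.{0})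
    (R : ∀ G : Scheme.{0}, (G ⟶ F₁₀) → Set G → Set G → List (Set G) → List (Set G) → Set G → Prop) : Prop :=
  ∀ (G G' : Scheme.{0}) (γ : G ⟶ F₁₀) (T E : Set G) (Es Ns : List (Set G)) (K : Set G) (y : redSub G (closure T) isClosed_closure)
      (υ₂ : G' ⟶ G) (hy : IsClosed ({curvePt G T y} : Set G)) (K' : Set G') (E' : Set G') (Es' Ns' : List (Set G')),
    R G γ T E Es Ns K →
    ¬ IsRegularLocalRing ((redSub G (closure T) isClosed_closure).presheaf.stalk y) →
    IsRegularLocalRing (G.presheaf.stalk (curvePt G T y)) →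
    IsBlowup υ₂ (Scheme.IdealSheafData.vanishingIdeal (⟨{curvePt G T y}, hy⟩ : Closeds G)) →
    (K' = ∅ ∨ (curvePt G T y ∉ closure K ∧ K' = closure (υ₂ ⁻¹' (K \ {curvePt G T y})))) →
    (E' = υ₂ ⁻¹' {curvePt G T y} ∨ (curvePt G T y ∉ E ∧ E' = closure (υ₂ ⁻¹' (E \ {curvePt G T y}))) ∨
      (∃ F ∈ E :: Es, E' = closure (υ₂ ⁻¹' (F \ {curvePt G T y})) ∧ K' = ∅)) →
    (∀ F' ∈ Es', (∃ F ∈ E :: Es, F' = closure (υ₂ ⁻¹' (F \ {curvePt G T y}))) ∨ F' = υ₂ ⁻¹' {curvePt G T y}) →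
    (∀ F' ∈ Ns', (∃ F ∈ (E :: Es) ++ Ns, F' = closure (υ₂ ⁻¹' (F \ {curvePt G T y}))) ∨ F' = υ₂ ⁻¹' {curvePt G T y}) →
    R G' (υ₂ ≫ γ) (closure (υ₂ ⁻¹' (T \ {curvePt G T y}))) E' Es' Ns' K'

/-- **`TowerRoundB₅ F₁₀ R`** — (T2) the CARRIER-FREE ROUND of the stage-0 tower (WIDTH TABLE D17): ✓ `TowerRoundBTriplePrime F₉ F₁₀ υ' Z₉ hZ₉ R` with the carrier
tokens DELETED — `TowerFull` ↦ the dimension clause «`Z̃` one-dimensional at its closed points» in branches 1 (host = the running surface `E`), 2 (host `Hst ∈ Es`)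
and 3 (PAIR round at a member crossing), sub-branch 1(i) (section round over the carrier) deleted, branch 4 (K-fibre), `IsBlowup`, `RoundTransportOKDoublePrime`,
`Ns'` and the conclusion verbatim; hence the signature `(F₁₀ R)`. [OURS · named hypothesis fragment, no mathematical content of its own] -/
def TowerRoundB₅ (F₁₀ : Scheme.{0})
    (R : ∀ G : Scheme.{0}, (G ⟶ F₁₀) → Set G → Set G → List (Set G) → List (Set G) → Set G → Prop) : Prop :=
  ∀ (G G' : Scheme.{0}) (γ : G ⟶ F₁₀) (T E : Set G) (Es Ns : List (Set G)) (K : Set G) (hE : IsClosed E) (Z : Set G) (hZ : IsClosed Z)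
      (Hst W : Set G) (υ₂ : G' ⟶ G) (K' : Set G') (E' : Set G') (Es' Ns' : List (Set G')),
    R G γ T E Es Ns K →
    Z ⊆ T → Z.Nonempty →
    (((∀ z : ↥(redSub G Z hZ), IsClosed ({z} : Set ↥(redSub G Z hZ)) → ringKrullDim ((redSub G Z hZ).presheaf.stalk z) = ((1 : ℕ) : WithBot ℕ∞)) ∧
        W = Hst ∧ Hst = E ∧ Z ⊆ E ∧
        (IsIrreducible Z ∧ (∀ x : redSub G Z hZ, IsRegularLocalRing ((redSub G Z hZ).presheaf.stalk x)) ∧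
          (∀ x : redSub G Z hZ, IsRegularLocalRing (G.presheaf.stalk (redSubι G Z hZ x))) ∧
          (∀ (i : redSub G Z hZ ⟶ redSub G E hE), i ≫ redSubι G E hE = redSubι G Z hZ →
            ∀ x : redSub G Z hZ, IsRegularLocalRing ((redSub G E hE).presheaf.stalk (i x))) ∧
          DirStepUnobs G E hE Z hZ) ∧
        (E' = υ₂ ⁻¹' Z ∨ E' = closure (υ₂ ⁻¹' (E \ Z))) ∧
        (K' = ∅ ∨ ((ConeWitness G E hE K Z hZ ∨ closure (Z \ closure K) = Z) ∧ K' = closure (υ₂ ⁻¹' (K \ Z))))) ∨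
      ((∀ z : ↥(redSub G Z hZ), IsClosed ({z} : Set ↥(redSub G Z hZ)) → ringKrullDim ((redSub G Z hZ).presheaf.stalk z) = ((1 : ℕ) : WithBot ℕ∞)) ∧
        W = Hst ∧ Hst ∈ Es ∧ ∃ hF : IsClosed Hst, Z ⊆ Hst ∧ IsIrreducible Z ∧
        (∀ x : redSub G Z hZ, IsRegularLocalRing ((redSub G Z hZ).presheaf.stalk x)) ∧
        (∀ x : redSub G Z hZ, IsRegularLocalRing (G.presheaf.stalk (redSubι G Z hZ x))) ∧
        (∀ (i : redSub G Z hZ ⟶ redSub G Hst hF), i ≫ redSubι G Hst hF = redSubι G Z hZ →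
          ∀ x : redSub G Z hZ, IsRegularLocalRing ((redSub G Hst hF).presheaf.stalk (i x))) ∧
        DirStepUnobs G Hst hF Z hZ ∧
        E' = υ₂ ⁻¹' Z ∧
        (K' = ∅ ∨ (Disjoint Z (closure K) ∧ K' = closure (υ₂ ⁻¹' (K \ Z))))) ∨
      -- the PAIR ROUND, FIBRE-or-full by the dimension clause alone (no carrier): centre = the reduced crossing curve of two model-carrying members
      ((∀ z : ↥(redSub G Z hZ), IsClosed ({z} : Set ↥(redSub G Z hZ)) → ringKrullDim ((redSub G Z hZ).presheaf.stalk z) = ((1 : ℕ) : WithBot ℕ∞)) ∧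
        Hst ∈ E :: Es ∧ W ∈ E :: Es ∧ Hst ≠ W ∧ ∃ (hH : IsClosed Hst) (_hW : IsClosed W),
        ConeWitness G Hst hH W Z hZ ∧
        (∀ x : redSub G Z hZ, IsRegularLocalRing ((redSub G Z hZ).presheaf.stalk x)) ∧
        E' = υ₂ ⁻¹' Z ∧
        (K' = ∅ ∨ ((((Hst = E ∨ W = E) ∧ closure (Z \ closure K) = Z) ∨ Disjoint Z (closure K)) ∧
          K' = closure (υ₂ ⁻¹' (K \ Z))))) ∨
      -- the K-FIBRE round — the shadow-witnessed round on the running surface, no dimension clause (verbatim)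
      (W = Hst ∧ Hst = E ∧ Z ⊆ E ∧ ConeWitness G E hE K Z hZ ∧
        (E' = υ₂ ⁻¹' Z ∨ E' = closure (υ₂ ⁻¹' (E \ Z))) ∧
        (K' = ∅ ∨ K' = closure (υ₂ ⁻¹' (K \ Z))))) →
    IsBlowup υ₂ (Scheme.IdealSheafData.vanishingIdeal (⟨Z, hZ⟩ : Closeds G)) →
    (∀ F' ∈ Es', ∃ F ∈ E :: Es, RoundTransportOKDoublePrime υ₂ Z hZ Hst W F F') →
    (∀ F' ∈ Ns', ∃ F ∈ (E :: Es) ++ Ns, F' = closure (υ₂ ⁻¹' (F \ Z))) →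
    R G' (υ₂ ≫ γ) (closure (υ₂ ⁻¹' (T \ Z))) E' Es' Ns' K'

/-- **`ReachTowerNose₀ k n T₁ F₉ β T₉ E₉`** — (T3) door τ0 «STAGE-0 TOWER» (WIDTH TABLE D17, customer #4 = H₁₀ ⊃ Z₁₅ «rational (6,10,15)-nose»): `E₉ = ∅` and a
B-tower motive `R G γ T E Es Ns K` SEEDED AT THE INITIAL STAGE ITSELF — `R ℙⁿ (𝟙 _) T₁ ∅ [] [] ∅`: no nose blow-up, no carrier, no slot, no curve clause, host `∅`,
empty lists — closed under `TowerPtRegB₅`, `TowerPtRamB₄`, `TowerRoundB₅`, reaching `R F₉ β T₉ E' Es' Ns' K'`.  `T₁` is instantiated `Set.range ι` by the blob;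
no `H`/`ι`/`γ'` binders (the body reads only `T₁`; there is no prior blow-up). [OURS · named hypothesis fragment, no mathematical content of its own] -/
def ReachTowerNose₀ (k : Type) [Field k] (n : ℕ) (T₁ : Set (Literature.AlgebraicGeometry.Motives.projectiveSpace n k).left) (F₉ : Scheme.{0}) (β : F₉ ⟶ (Literature.AlgebraicGeometry.Motives.projectiveSpace n k).left) (T₉ E₉ : Set F₉) : Prop :=
  E₉ = ∅ ∧
  ∃ (E' : Set F₉) (Es' Ns' : List (Set F₉)) (K' : Set F₉),
    ∀ R : (∀ G : Scheme.{0}, (G ⟶ (Literature.AlgebraicGeometry.Motives.projectiveSpace n k).left) → Set G → Set G → List (Set G) → List (Set G) → Set G → Prop),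
      R (Literature.AlgebraicGeometry.Motives.projectiveSpace n k).left (𝟙 (Literature.AlgebraicGeometry.Motives.projectiveSpace n k).left) T₁ ∅ [] [] ∅ →
      TowerPtRegB₅ (Literature.AlgebraicGeometry.Motives.projectiveSpace n k).left R → TowerPtRamB₄ (Literature.AlgebraicGeometry.Motives.projectiveSpace n k).left R → TowerRoundB₅ (Literature.AlgebraicGeometry.Motives.projectiveSpace n k).left R →
      R F₉ β T₉ E' Es' Ns' K'

/-- **`NoseHypHostedNestEquinodalDirectCILiftTowerZeroSigmaPGBTriplePrime₂ k n H ι`** (D17 blob E9, initial menu «(((ν4 ∨ ν3ᵈΣPG) ∨ ν3ᶜⁱΣPG) ∨ νLIFT) ∨ τ0») —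
✓ blob E8 (…DefsE8) VERBATIM except that the initial-stage nose menu has ONE MORE disjunct `ReachTowerNose₀ k n (Set.range ι) F₉ β T₉ E₉`.  More doors asked of `Q`
⇒ implied by blob E8 (`…_of_liftSigmaPG₂` below, pure logic); REPLACE shape «¬(E8 blob) ↦ ¬(this blob)» (52nd-or-later, desk).
[OURS · L1 W4.5b · named hypothesis, no mathematical content of its own] -/
def NoseHypHostedNestEquinodalDirectCILiftTowerZeroSigmaPGBTriplePrime₂ (k : Type) [Field k] [IsAlgClosed k] (n : ℕ) (H : AlgebraicGeometry.Scheme.{0})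
    (ι : H ⟶ (Literature.AlgebraicGeometry.Motives.projectiveSpace n k).left) : Prop :=
  letI := MvPolynomial.gradedAlgebra (σ := Fin (n + 1)) (R := k)
  ∃ (E₀ : Set (Literature.AlgebraicGeometry.Motives.projectiveSpace n k).left),
    (E₀ = ∅ ∨ ∃ ℓ : MvPolynomial (Fin (n + 1)) k, ℓ.IsHomogeneous 1 ∧ ℓ ≠ 0 ∧
      ¬ (Set.range ι ⊆ {y : (Literature.AlgebraicGeometry.Motives.projectiveSpace n k).left |
        ℓ ∈ (y : ProjectiveSpectrum (MvPolynomial.homogeneousSubmodule (Fin (n + 1)) k)).asHomogeneousIdeal}) ∧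
      E₀ = {y : (Literature.AlgebraicGeometry.Motives.projectiveSpace n k).left |
        ℓ ∈ (y : ProjectiveSpectrum (MvPolynomial.homogeneousSubmodule (Fin (n + 1)) k)).asHomogeneousIdeal}) ∧
    (∃ (F' : AlgebraicGeometry.Scheme.{0}) (ρ' : F' ⟶ (Literature.AlgebraicGeometry.Motives.projectiveSpace n k).left) (T' : Set F'),
      (∀ Q : (∀ F₁ : AlgebraicGeometry.Scheme.{0}, (F₁ ⟶ (Literature.AlgebraicGeometry.Motives.projectiveSpace n k).left) → Set F₁ → Set F₁ → Prop),
        Q (Literature.AlgebraicGeometry.Motives.projectiveSpace n k).left (𝟙 (Literature.AlgebraicGeometry.Motives.projectiveSpace n k).left) (Set.range ι) E₀ →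
        (∀ (F₁ F₂ : AlgebraicGeometry.Scheme.{0}) (ρ : F₁ ⟶ (Literature.AlgebraicGeometry.Motives.projectiveSpace n k).left) (T₁ E₁ : Set F₁)
            (x : ↥((AlgebraicGeometry.Scheme.IdealSheafData.vanishingIdeal (⟨closure T₁, isClosed_closure⟩ : TopologicalSpace.Closeds F₁))).subscheme) (υ : F₂ ⟶ F₁) (hx : IsClosed ({(((AlgebraicGeometry.Scheme.IdealSheafData.vanishingIdeal (⟨closure T₁, isClosed_closure⟩ : TopologicalSpace.Closeds F₁))).subschemeι x : F₁)} : Set F₁)),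
          Q F₁ ρ T₁ E₁ → ¬ IsRegularLocalRing (((AlgebraicGeometry.Scheme.IdealSheafData.vanishingIdeal (⟨closure T₁, isClosed_closure⟩ : TopologicalSpace.Closeds F₁))).subscheme.presheaf.stalk x) →
          IsRegularLocalRing (F₁.presheaf.stalk (((AlgebraicGeometry.Scheme.IdealSheafData.vanishingIdeal (⟨closure T₁, isClosed_closure⟩ : TopologicalSpace.Closeds F₁))).subschemeι x : F₁)) →
          ((((AlgebraicGeometry.Scheme.IdealSheafData.vanishingIdeal (⟨closure T₁, isClosed_closure⟩ : TopologicalSpace.Closeds F₁))).subschemeι x : F₁) ∈ closure E₁ → ∀ e : ↥(redSub F₁ (closure E₁) isClosed_closure), (redSubι F₁ (closure E₁) isClosed_closure e : F₁) = (((AlgebraicGeometry.Scheme.IdealSheafData.vanishingIdeal (⟨closure T₁, isClosed_closure⟩ : TopologicalSpace.Closeds F₁))).subschemeι x : F₁) →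
          IsRegularLocalRing ((redSub F₁ (closure E₁) isClosed_closure).presheaf.stalk e)) → Literature.AlgebraicGeometry.Resolution.IsBlowup υ
            (AlgebraicGeometry.Scheme.IdealSheafData.vanishingIdeal (⟨{(((AlgebraicGeometry.Scheme.IdealSheafData.vanishingIdeal (⟨closure T₁, isClosed_closure⟩ : TopologicalSpace.Closeds F₁))).subschemeι x : F₁)}, hx⟩ : TopologicalSpace.Closeds F₁)) →
          Q F₂ (υ ≫ ρ) (closure (υ ⁻¹' (T₁ \ {(((AlgebraicGeometry.Scheme.IdealSheafData.vanishingIdeal (⟨closure T₁, isClosed_closure⟩ : TopologicalSpace.Closeds F₁))).subschemeι x : F₁)}))) (closure (υ ⁻¹' (E₁ \ {(((AlgebraicGeometry.Scheme.IdealSheafData.vanishingIdeal (⟨closure T₁, isClosed_closure⟩ : TopologicalSpace.Closeds F₁))).subschemeι x : F₁)})))) →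
        -- STAGE-LEVEL HOSTED ROUND at a regular curve `Z` inside the host, unobstructed IN THE HOST (in-host NEST lines and the nose curve alike)
        (∀ (F₁ F₃ : AlgebraicGeometry.Scheme.{0}) (ρ : F₁ ⟶ (Literature.AlgebraicGeometry.Motives.projectiveSpace n k).left) (T₁ E₁ : Set F₁) (Z : Set F₁) (hZ : IsClosed Z) (υ' : F₃ ⟶ F₁),
          Q F₁ ρ T₁ E₁ → Z ⊆ closure E₁ → Z ⊆ T₁ → ¬ T₁ ⊆ Z → (∀ z : ↥(redSub F₁ Z hZ), IsRegularLocalRing ((redSub F₁ Z hZ).presheaf.stalk z)) →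
          (∀ (i : redSub F₁ Z hZ ⟶ redSub F₁ (closure E₁) isClosed_closure), i ≫ redSubι F₁ (closure E₁) isClosed_closure = redSubι F₁ Z hZ →
            ∀ z : ↥(redSub F₁ Z hZ), IsRegularLocalRing ((redSub F₁ (closure E₁) isClosed_closure).presheaf.stalk (i z))) → DirStepUnobs F₁ (closure E₁) isClosed_closure Z hZ →
          (∀ z : ↥(redSub F₁ Z hZ), IsClosed ({z} : Set ↥(redSub F₁ Z hZ)) → ringKrullDim ((redSub F₁ Z hZ).presheaf.stalk z) = ((1 : ℕ) : WithBot ℕ∞)) →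
          Literature.AlgebraicGeometry.Resolution.IsBlowup υ' (AlgebraicGeometry.Scheme.IdealSheafData.vanishingIdeal (⟨Z, hZ⟩ : TopologicalSpace.Closeds F₁)) →
          Q F₃ (υ' ≫ ρ) (closure (υ' ⁻¹' (T₁ \ Z))) (closure (υ' ⁻¹' (closure E₁ \ Z)))) →
        (∀ (F₁ : AlgebraicGeometry.Scheme.{0}) (ρ : F₁ ⟶ (Literature.AlgebraicGeometry.Motives.projectiveSpace n k).left) (T₁ E₁ : Set F₁) (F₉ : AlgebraicGeometry.Scheme.{0}) (β : F₉ ⟶ F₁) (T₉ E₉ : Set F₉),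
          Q F₁ ρ T₁ E₁ → ReachHostedNoseBTriplePrime F₁ T₁ E₁ F₉ β T₉ E₉ → Q F₉ (β ≫ ρ) T₉ E₉) →
        -- INITIAL-STAGE NOSE, host named as the hyperplane `E₀ = V₊(ℓ)`: door ν4 «EQUINODAL» OR door ν3ᵈΣPG «DIRECT PLANAR» (both inside the host) OR door ν3ᶜⁱΣPG
        -- «ci-DIRECT» (host-free, `ℓ` a dummy) OR — NEW, D15 — door νLIFT «ν-LIFT NOSE» (`ReachLiftNoseSigmaPG₂`: host-free, door-owned point steps at `S`, the
        -- round at the strict transform of `Z` with an upstairs centre handed by the slot `NoseLift₀`, then a B‴ tail)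
        -- OR — NEW, D17 — door τ0 «STAGE-0 TOWER» (`ReachTowerNose₀`: host-free, no nose blow-up, no carrier, no slot: a B-tower seeded at the stage itself,
        -- closed under point steps that may keep a member THROUGH the point model-carrying, fat point steps, and carrier-free hosted / pair / K-fibre rounds)
        (∀ (ℓ : MvPolynomial (Fin (n + 1)) k) (F₉ : AlgebraicGeometry.Scheme.{0}) (β : F₉ ⟶ (Literature.AlgebraicGeometry.Motives.projectiveSpace n k).left) (T₉ E₉ : Set F₉),
          Q (Literature.AlgebraicGeometry.Motives.projectiveSpace n k).left (𝟙 (Literature.AlgebraicGeometry.Motives.projectiveSpace n k).left) (Set.range ι) E₀ →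
          E₀ = {y : (Literature.AlgebraicGeometry.Motives.projectiveSpace n k).left |
            ℓ ∈ (y : ProjectiveSpectrum (MvPolynomial.homogeneousSubmodule (Fin (n + 1)) k)).asHomogeneousIdeal} →
          ((((ReachEquinodalPlanarNose₂ k n ℓ (Set.range ι) F₉ β T₉ E₉ ∨ ReachDirectPlanarNoseSigmaPG₂ k n ℓ (Set.range ι) F₉ β T₉ E₉) ∨
              ReachDirectCINoseSigmaPG₂ k n (Set.range ι) F₉ β T₉ E₉) ∨
              ReachLiftNoseSigmaPG₂ k n H ι (Set.range ι) F₉ β T₉ E₉) ∨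
              ReachTowerNose₀ k n (Set.range ι) F₉ β T₉ E₉) →
            Q F₉ β T₉ E₉) → ∃ E' : Set F', Q F' ρ' T' E') ∧
      Literature.AlgebraicGeometry.Resolution.Scheme.IsRegular (AlgebraicGeometry.Scheme.IdealSheafData.vanishingIdeal (⟨closure T', isClosed_closure⟩ : TopologicalSpace.Closeds F')).subscheme)


/-- (T5a) the wider point-step rule implies the narrower on motives: a motive closed under `TowerPtRegB₅` is closed under ✓ `TowerPtRegB₄` (every B₄-step is a
B₅-step — forget `curvePt G T y ∉ F`).  For the engine's reuse of ✓ `Tower.invB₄_ptRegStep` on the old arms. [OURS · pure logic] -/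
theorem towerPtRegB₄_of_towerPtRegB₅ (F₁₀ : Scheme.{0})
    (R : ∀ G : Scheme.{0}, (G ⟶ F₁₀) → Set G → Set G → List (Set G) → List (Set G) → Set G → Prop)
    (h : TowerPtRegB₅ F₁₀ R) : TowerPtRegB₄ F₁₀ R := by
  intro G G' γ T E Es Ns K y υ₂ hy K' E' Es' Ns' hR hnreg hreg hυ hK hE hEs hNs
  refine h G G' γ T E Es Ns K y υ₂ hy K' E' Es' Ns' hR hnreg hreg hυ hK ?_ ?_ hNs
  · rcases hE with hE | hE | ⟨F, hF, -, hE, hK'⟩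
    · exact Or.inl hE
    · exact Or.inr (Or.inl hE)
    · exact Or.inr (Or.inr ⟨F, hF, hE, hK'⟩)
  · intro F' hF'
    rcases hEs F' hF' with ⟨F, hF, -, hF'⟩ | hF'
    · exact Or.inl ⟨F, hF, hF'⟩
    · exact Or.inr hF'

/-- blob E8 (✓ DefsE8, the 51st's residue blob) ⇒ blob E9: a motive closed under the WIDER initial menu is closed under E8's. [OURS · pure logic] -/
theorem noseHypHostedNestEquinodalDirectCILiftTowerZeroSigmaPGBTriplePrime₂_of_liftSigmaPG₂ (k : Type) [Field k] [IsAlgClosed k] (n : ℕ)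
    (H : AlgebraicGeometry.Scheme.{0}) (ι : H ⟶ (Literature.AlgebraicGeometry.Motives.projectiveSpace n k).left)
    (h : NoseHypHostedNestEquinodalDirectCILiftSigmaPGBTriplePrime₂ k n H ι) :
    NoseHypHostedNestEquinodalDirectCILiftTowerZeroSigmaPGBTriplePrime₂ k n H ι := by
  obtain ⟨E₀, hE₀, F', ρ', T', hQ, hreg⟩ := h
  refine ⟨E₀, hE₀, F', ρ', T', fun Q hQ0 hpt hround hreach hmenu => hQ Q hQ0 hpt hround hreach ?_, hreg⟩
  intro ℓ F₉ β T₉ E₉ hQ₀ hE hR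
  exact hmenu ℓ F₉ β T₉ E₉ hQ₀ hE (Or.inl hR)

/-- the ΣPG blob (✓ DefsE7) ⇒ blob E9. [OURS · pure logic] -/
theorem noseHypHostedNestEquinodalDirectCILiftTowerZeroSigmaPGBTriplePrime₂_of_directCISigmaPG₂ (k : Type) [Field k] [IsAlgClosed k] (n : ℕ)
    (H : AlgebraicGeometry.Scheme.{0}) (ι : H ⟶ (Literature.AlgebraicGeometry.Motives.projectiveSpace n k).left)
    (h : NoseHypHostedNestEquinodalDirectCISigmaPGBTriplePrime₂ k n H ι) :
    NoseHypHostedNestEquinodalDirectCILiftTowerZeroSigmaPGBTriplePrime₂ k n H ι :=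
  noseHypHostedNestEquinodalDirectCILiftTowerZeroSigmaPGBTriplePrime₂_of_liftSigmaPG₂ k n H ι
    (noseHypHostedNestEquinodalDirectCILiftSigmaPGBTriplePrime₂_of_directCISigmaPG₂ k n H ι h)

/-- Contrapositive, as a D17 REPLACE cut «¬(E8 blob) ↦ ¬(E9 blob)» consumes it: the new residue hypothesis implies the old one. [OURS · pure logic] -/
theorem not_noseHypHostedNestEquinodalDirectCILiftSigmaPGBTriplePrime₂_of_not_liftTowerZeroSigmaPG₂ (k : Type) [Field k] [IsAlgClosed k] (n : ℕ)
    (H : AlgebraicGeometry.Scheme.{0}) (ι : H ⟶ (Literature.AlgebraicGeometry.Motives.projectiveSpace n k).left)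
    (h : ¬ NoseHypHostedNestEquinodalDirectCILiftTowerZeroSigmaPGBTriplePrime₂ k n H ι) :
    ¬ NoseHypHostedNestEquinodalDirectCILiftSigmaPGBTriplePrime₂ k n H ι :=
  fun h' => h (noseHypHostedNestEquinodalDirectCILiftTowerZeroSigmaPGBTriplePrime₂_of_liftSigmaPG₂ k n H ι h')

/-- … `¬ (E9 blob) → ¬ (ΣPG blob)` (50th-level). [OURS · pure logic] -/
theorem not_noseHypHostedNestEquinodalDirectCISigmaPGBTriplePrime₂_of_not_liftTowerZeroSigmaPG₂ (k : Type) [Field k] [IsAlgClosed k] (n : ℕ)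
    (H : AlgebraicGeometry.Scheme.{0}) (ι : H ⟶ (Literature.AlgebraicGeometry.Motives.projectiveSpace n k).left)
    (h : ¬ NoseHypHostedNestEquinodalDirectCILiftTowerZeroSigmaPGBTriplePrime₂ k n H ι) :
    ¬ NoseHypHostedNestEquinodalDirectCISigmaPGBTriplePrime₂ k n H ι :=
  not_noseHypHostedNestEquinodalDirectCISigmaPGBTriplePrime₂_of_not_liftSigmaPG₂ k n H ι
    (not_noseHypHostedNestEquinodalDirectCILiftSigmaPGBTriplePrime₂_of_not_liftTowerZeroSigmaPG₂ k n H ι h)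

/-- … `¬ (E9 blob) → ¬ (Σ blob)` (49th-level). [OURS · pure logic] -/
theorem not_noseHypHostedNestEquinodalDirectCISigmaBTriplePrime₂_of_not_liftTowerZeroSigmaPG₂ (k : Type) [Field k] [IsAlgClosed k] (n : ℕ)
    (H : AlgebraicGeometry.Scheme.{0}) (ι : H ⟶ (Literature.AlgebraicGeometry.Motives.projectiveSpace n k).left)
    (h : ¬ NoseHypHostedNestEquinodalDirectCILiftTowerZeroSigmaPGBTriplePrime₂ k n H ι) :
    ¬ NoseHypHostedNestEquinodalDirectCISigmaBTriplePrime₂ k n H ι :=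
  not_noseHypHostedNestEquinodalDirectCISigmaBTriplePrime₂_of_not_liftSigmaPG₂ k n H ι
    (not_noseHypHostedNestEquinodalDirectCILiftSigmaPGBTriplePrime₂_of_not_liftTowerZeroSigmaPG₂ k n H ι h)

/-- … `¬ (E9 blob) → ¬ (47th blob)`. [OURS · pure logic] -/
theorem not_noseHypHostedNestEquinodalDirectCIBTriplePrime₂_of_not_liftTowerZeroSigmaPG₂ (k : Type) [Field k] [IsAlgClosed k] (n : ℕ)
    (H : AlgebraicGeometry.Scheme.{0}) (ι : H ⟶ (Literature.AlgebraicGeometry.Motives.projectiveSpace n k).left)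
    (h : ¬ NoseHypHostedNestEquinodalDirectCILiftTowerZeroSigmaPGBTriplePrime₂ k n H ι) :
    ¬ NoseHypHostedNestEquinodalDirectCIBTriplePrime₂ k n H ι :=
  not_noseHypHostedNestEquinodalDirectCIBTriplePrime₂_of_not_liftSigmaPG₂ k n H ι
    (not_noseHypHostedNestEquinodalDirectCILiftSigmaPGBTriplePrime₂_of_not_liftTowerZeroSigmaPG₂ k n H ι h)

/-- … `¬ (E9 blob) → ¬ (46th blob)`. [OURS · pure logic] -/
theorem not_noseHypHostedNestEquinodalDirectBTriplePrime₂_of_not_liftTowerZeroSigmaPG₂ (k : Type) [Field k] [IsAlgClosed k] (n : ℕ)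
    (H : AlgebraicGeometry.Scheme.{0}) (ι : H ⟶ (Literature.AlgebraicGeometry.Motives.projectiveSpace n k).left)
    (h : ¬ NoseHypHostedNestEquinodalDirectCILiftTowerZeroSigmaPGBTriplePrime₂ k n H ι) :
    ¬ NoseHypHostedNestEquinodalDirectBTriplePrime₂ k n H ι :=
  not_noseHypHostedNestEquinodalDirectBTriplePrime₂_of_not_liftSigmaPG₂ k n H ι
    (not_noseHypHostedNestEquinodalDirectCILiftSigmaPGBTriplePrime₂_of_not_liftTowerZeroSigmaPG₂ k n H ι h)

/-- … `¬ (E9 blob) → ¬ blob₃ᵉ v2`. [OURS · pure logic] -/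
theorem not_noseHypHostedNestEquinodalBTriplePrime₂_of_not_liftTowerZeroSigmaPG₂ (k : Type) [Field k] [IsAlgClosed k] (n : ℕ)
    (H : AlgebraicGeometry.Scheme.{0}) (ι : H ⟶ (Literature.AlgebraicGeometry.Motives.projectiveSpace n k).left)
    (h : ¬ NoseHypHostedNestEquinodalDirectCILiftTowerZeroSigmaPGBTriplePrime₂ k n H ι) :
    ¬ NoseHypHostedNestEquinodalBTriplePrime₂ k n H ι :=
  not_noseHypHostedNestEquinodalBTriplePrime₂_of_not_liftSigmaPG₂ k n H ι
    (not_noseHypHostedNestEquinodalDirectCILiftSigmaPGBTriplePrime₂_of_not_liftTowerZeroSigmaPG₂ k n H ι h)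

/-- … `¬ (E9 blob) → ¬ blob₂`. [OURS · pure logic] -/
theorem not_noseHypHostedNestBTriplePrime₂_of_not_liftTowerZeroSigmaPG₂ (k : Type) [Field k] [IsAlgClosed k] (n : ℕ)
    (H : AlgebraicGeometry.Scheme.{0}) (ι : H ⟶ (Literature.AlgebraicGeometry.Motives.projectiveSpace n k).left)
    (h : ¬ NoseHypHostedNestEquinodalDirectCILiftTowerZeroSigmaPGBTriplePrime₂ k n H ι) :
    ¬ NoseHypHostedNestBTriplePrime₂ k n H ι :=
  not_noseHypHostedNestBTriplePrime₂_of_not_liftSigmaPG₂ k n H ι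
    (not_noseHypHostedNestEquinodalDirectCILiftSigmaPGBTriplePrime₂_of_not_liftTowerZeroSigmaPG₂ k n H ι h)

/-- … `¬ (E9 blob) → ¬ NoseHypPointsFirstBTriplePrime`. [OURS · pure logic] -/
theorem not_noseHypPointsFirstBTriplePrime_of_not_liftTowerZeroSigmaPG₂ (k : Type) [Field k] [IsAlgClosed k] (n : ℕ)
    (H : AlgebraicGeometry.Scheme.{0}) (ι : H ⟶ (Literature.AlgebraicGeometry.Motives.projectiveSpace n k).left)
    (h : ¬ NoseHypHostedNestEquinodalDirectCILiftTowerZeroSigmaPGBTriplePrime₂ k n H ι) :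
    ¬ NoseHypPointsFirstBTriplePrime k n H ι :=
  not_noseHypPointsFirstBTriplePrime_of_not_liftSigmaPG₂ k n H ι
    (not_noseHypHostedNestEquinodalDirectCILiftSigmaPGBTriplePrime₂_of_not_liftTowerZeroSigmaPG₂ k n H ι h)

end Summit.ResolutionOfSingularities.ResolutionOfSingularities.Cruxes.EquisingularLiftNat.Sections

end
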